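import Summits.ValiantsHypothesis.ValiantsHypothesis.Theses.SOSTau

/-!
# Negative lemma around crux `SOSTau` (route SOSTau, item stmt-ValiantsHypothesis-18748):
# the support-SUM (not the support-UNION / Gram frame) is load-bearing

Crux-disprover artefact (cdisprove cycle 1).  It does not refute `SOSTau`; it shows that the
accounting `Σᵢ |supp gᵢ|` cannot be weakened to the size of the common monomial frame
`|⋃ᵢ supp gᵢ|` — equivalently, a Gram / quadratic-form representation `f = w(x)ᵀ Q w(x)` over a
monomial vector `w` may NOT be charged `|w|` only:

* `sosTau_false_with_support_union` — with the digit frame `A = {0,…,m−1} ∪ m·{0,…,m−1}`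
  (`|A| ≤ 2m`), every `X^k` with `k < m²` is `X^(k % m) · X^(m (k / m))`, a weighted difference of
  the two binomial squares `(X^(k % m) ± X^(m (k / m)))²` supported in `A`; hence EVERY real
  polynomial of degree `< m²` is a weighted sum of `2m²` squares of binomials supported in `A`.
  Taking `f = ∏_{k < m²−1} (X − k)` gives `m² − 1` distinct real zeros against a frame of size
  `≤ 2m`.  (The support-SUM of this representation is `4m²`, consistent with the crux.)  So any
  proof of the crux must charge every square for its own support — rank × sparsity — and no
  bound in terms of the frame alone survives.

Companion files: `LoadBearing.lean`, `SOSTauFalseOverComplex.lean`.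
-/

set_option linter.dupNamespace false

namespace Summit.ValiantsHypothesis.ValiantsHypothesis.Theorems.SOSTau.Negative

open Polynomial Finset

/-- Polarisation with the weight carried by `C`: `C c · X^i · X^j` is the weighted difference of
the binomial squares `(X^i ± X^j)²`. [folklore] -/
theorem C_mul_X_pow_mul_X_pow_eq_polarised (c : ℝ) (i j : ℕ) :
    C c * ((X : ℝ[X]) ^ i * X ^ j) = C (c * (1/4)) * (X ^ i + X ^ j) ^ 2
      + C (-(c * (1/4))) * (X ^ i - X ^ j) ^ 2 := by
  have h4 : C (1/4 : ℝ) * (4 : ℝ[X]) = 1 := by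
    rw [← map_ofNat C 4, ← map_mul]; norm_num
  simp only [map_mul, map_neg]
  linear_combination (-(C c * X ^ i * X ^ j)) * h4

/-- `SOSTau` with the support-SUM `Σ |supp gᵢ|` weakened to the support-UNION `|⋃ supp gᵢ|` is
FALSE.  Witness for a purported constant `c`: `m = 2c+2`, `f = ∏_{k<m²−1} (X − k)` written over
the digit frame `{0,…,m−1} ∪ m·{0,…,m−1}` by polarised binomial squares:
`m² − 1 = 4c² + 8c + 3` distinct real zeros against `c · 2m = 4c² + 4c`. [folklore] -/
theorem sosTau_false_with_support_union :
    ¬ ∃ c : ℕ, ∀ (s : ℕ) (a : Fin s → ℝ) (g : Fin s → Polynomial ℝ),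
      (∑ i, Polynomial.C (a i) * g i ^ 2).roots.toFinset.card ≤
        c * (Finset.univ.biUnion fun i => (g i).support).card := by
  rintro ⟨c, hc⟩
  -- parameters
  set m : ℕ := 2 * c + 2 with hm
  set D : ℕ := m ^ 2 - 1 with hD
  have hm0 : 0 < m := by omega
  have hDm : D < m ^ 2 := by
    have : 0 < m ^ 2 := by positivity
    omega
  -- the target polynomial: `D` distinct real zeros `0, 1, …, D-1`
  set rs : Finset ℝ := (Finset.range D).image (fun k : ℕ => (k : ℝ)) with hrs
  set f : ℝ[X] := rs.prod (fun r => X - C r) with hf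
  have hcard_rs : rs.card = D := by
    rw [hrs, Finset.card_image_of_injective _ Nat.cast_injective, Finset.card_range]
  have hroots : f.roots.toFinset.card = D := by
    rw [hf, roots_prod_X_sub_C, Finset.val_toFinset, hcard_rs]
  have hdeg : f.natDegree < m ^ 2 := by
    rw [hf, natDegree_finsetProd_X_sub_C_eq_card, hcard_rs]; exact hDm
  -- the representation: `2·m²` binomial squares over the digit frame
  let g₁ : Fin (m ^ 2) → ℝ[X] := fun k => X ^ ((k : ℕ) % m) + X ^ (m * ((k : ℕ) / m))
  let g₂ : Fin (m ^ 2) → ℝ[X] := fun k => X ^ ((k : ℕ) % m) - X ^ (m * ((k : ℕ) / m))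
  let a₁ : Fin (m ^ 2) → ℝ := fun k => f.coeff k * (1/4)
  let a₂ : Fin (m ^ 2) → ℝ := fun k => -(f.coeff k * (1/4))
  have h := hc (m ^ 2 + m ^ 2) (Fin.append a₁ a₂) (Fin.append g₁ g₂)
  have hrep : (∑ i, Polynomial.C (Fin.append a₁ a₂ i) * Fin.append g₁ g₂ i ^ 2) = f := by
    rw [Fin.sum_univ_add]
    simp only [Fin.append_left, Fin.append_right]
    rw [← Finset.sum_add_distrib]
    conv_rhs => rw [as_sum_range' f (m ^ 2) hdeg, ← Fin.sum_univ_eq_sum_range]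
    refine Finset.sum_congr rfl fun k _ => ?_
    have hk : (X : ℝ[X]) ^ (k : ℕ) = X ^ ((k : ℕ) % m) * X ^ (m * ((k : ℕ) / m)) := by
      rw [← pow_add, Nat.mod_add_div]
    rw [← C_mul_X_pow_eq_monomial, hk]
    simp only [a₁, a₂, g₁, g₂]
    exact (C_mul_X_pow_mul_X_pow_eq_polarised (f.coeff k) _ _).symm
  -- the frame
  set A : Finset ℕ := Finset.range m ∪ (Finset.range m).image (fun j => m * j) with hA
  have hA_card : A.card ≤ m + m := by
    calc A.card ≤ (Finset.range m).card + ((Finset.range m).image (fun j => m * j)).card :=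
          Finset.card_union_le _ _
      _ ≤ m + m := by
          rw [Finset.card_range]
          exact Nat.add_le_add_left (Finset.card_image_le.trans (by rw [Finset.card_range])) _
  have hmem1 : ∀ k : Fin (m ^ 2), (k : ℕ) % m ∈ A := fun k => by
    rw [hA, Finset.mem_union]; left
    exact Finset.mem_range.mpr (Nat.mod_lt _ hm0)
  have hmem2 : ∀ k : Fin (m ^ 2), m * ((k : ℕ) / m) ∈ A := fun k => by
    rw [hA, Finset.mem_union]; right
    refine Finset.mem_image.mpr ⟨(k : ℕ) / m, Finset.mem_range.mpr ?_, rfl⟩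
    exact Nat.div_lt_of_lt_mul (by rw [← sq]; exact k.isLt)
  have hU : (Finset.univ.biUnion fun i => (Fin.append g₁ g₂ i).support) ⊆ A := by
    intro e he
    rw [Finset.mem_biUnion] at he
    obtain ⟨i, -, hi⟩ := he
    refine Fin.addCases (motive := fun i => e ∈ (Fin.append g₁ g₂ i).support → e ∈ A)
      (fun k hk => ?_) (fun k hk => ?_) i hi
    · rw [Fin.append_left] at hk
      have hk' := Polynomial.support_add hk
      rw [Finset.mem_union, Polynomial.support_X_pow, Polynomial.support_X_pow,
        Finset.mem_singleton, Finset.mem_singleton] at hk'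
      rcases hk' with rfl | rfl
      exacts [hmem1 k, hmem2 k]
    · rw [Fin.append_right] at hk
      simp only [g₂, sub_eq_add_neg] at hk
      have hk' := Polynomial.support_add hk
      rw [Finset.mem_union, Polynomial.support_neg, Polynomial.support_X_pow,
        Polynomial.support_X_pow, Finset.mem_singleton, Finset.mem_singleton] at hk'
      rcases hk' with rfl | rfl
      exacts [hmem1 k, hmem2 k]
  rw [hrep, hroots] at h
  have hle : D ≤ c * (m + m) :=
    h.trans (Nat.mul_le_mul_left c ((Finset.card_le_card hU).trans hA_card))
  -- arithmetic: `D = (2c+2)² − 1 = 4c² + 8c + 3 > c(4c + 4)`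
  rw [hD, hm] at hle
  have : (2 * c + 2) ^ 2 = c * (2 * c + 2 + (2 * c + 2)) + 4 * c + 4 := by ring
  omega

end Summit.ValiantsHypothesis.ValiantsHypothesis.Theorems.SOSTau.Negative
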